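import Summits.HodgeConjecture.HodgeConjecture.Theorems.K2LiuUnramifiedSectionOnCartan
import Literature.NumberTheory.Automorphic.LocalUnitaryGroupCongr

/-!
# The explicit Iwasawa blocks of a Cartan element of the doubled unitary group at an INERT place (inert package, organ of #27i)

Track B ∕ K2-LIT, hLiu418 = stmt-HodgeConjecture-24832; LEAD F0P6-plan (g10) deal 2026-09-04 02:26:33Z (inert package → K2Liu-p01), words
`K2/K2Liu-p01/g3/INERT-SOCKETS-v2.K2Liup01g3.md` §0. Helper (count-neutral): the matrix algebra behind ★-to-be
`K2LiuUnramifiedSectionOnCartanInert.lambdaLoc_iotaLeftLocPi_cartan_inert` (the inert twin of ★ #27). In a hyperbolic frame of the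
curve datum `(e : Fin 2 × Fin 1 ≃ Fin n, dV, dW)` at an inert place the two doubled lines `⟨e, e⁻⟩`, `⟨f, f⁻⟩` are Lagrangians in
duality, so the `|a| ≤ 1` line block of ★ `K2LiuSplitCartanIwasawa`, `κ₀ = [[a+1, −1], [1, 0]]`, and its `h'`-dual `κ₁ = [[0, 1], [−1, a+1]]`
assemble to a unitary integral `k` with `diag(a ⊕ a⁻¹, 1)·k⁻¹ ∈ P_Δ`:
* §1 the scalar identities per line (`κκ⁻¹ = 1`, duality-unitarity `κ₀ᵀ·diag(1,−1)·κ₁ = diag(1,−1)`, the Siegel row-sum condition, `det_Δ`);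
* §2 the `(n+n) × (n+n)` matrices in the hyperbolic frame (`kMat_mul_lMat`, `dMat_mul_lMat`, `kMat_transpose_mul_form_mul_kMat`) and the
  block-scalar frame calculus (`frame_conj_blocks`, `frame_mul_frame`, `frame_transpose_mul_form_mul_frame`);
* §3 the doubled Gram matrix of the curve datum at `w` in the frame: `gramW = dW₀ · (σ_w T')ᵀ J' T'` (`gramW_eq_smul_frame`).
[Li1992, §3 Thm. 3.1]; [Kudla1994, §3]; [HarrisKudlaSweet1996, §1 (1.9)–(1.11)]. No `def`, no `sorry`.
HONEST LABEL: HC_CM is proved only modulo the printed citations (2 remaining named inputs: hLiu418 = stmt-HodgeConjecture-24832,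
h413 = stmt-HodgeConjecture-24833) until rung 0 closes; this file is unconditional and moves no counter.
-/

set_option autoImplicit false

set_option linter.dupNamespace false

noncomputable section

open scoped Matrix Kronecker
open NumberField IsDedekindDomain Matrix

namespace Summit.HodgeConjecture.HodgeConjecture.Cruxes.HLiu418.K2LiuInertCartanIwasawaBlocks

open Literature.NumberTheory.Automorphic Literature.NumberTheory.Automorphic.UnitaryGroup Literature.NumberTheory.GaloisRepresentations
open Literature.NumberTheory.GelbartRogawski1991 Literature.NumberTheory.GelbartRogawski1991.GRConstruction
open Literature.NumberTheory.GelbartRogawski1991.UnitaryDualPair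
open Literature.NumberTheory.K2Lit Literature.NumberTheory.K2Lit.SiegelDoubled
open Summit.HodgeConjecture.HodgeConjecture.Cruxes.HLiu418.K2LiuSplitCartanIwasawa
open Summit.HodgeConjecture.HodgeConjecture.Cruxes.HLiu418.K2LiuUnramifiedSectionOnCartan

/-! ## §1 The per-line `2 × 2` blocks (any field): `κ₀ = [[a+1, −1], [1, 0]]` on the line of `e`, `κ₁ = [[0, 1], [−1, a+1]]` on the line of `f`

The four entry families `Fin 2 → K` of `k` are `![a+1, 0]`, `![-1, 1]`, `![1, -1]`, `![0, a+1]`; those of `k⁻¹` are `![0, a+1]`, `![1, -1]`,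
`![-1, 1]`, `![a+1, 0]`; the Cartan eigenvalues on the two lines are `![a, a⁻¹]`. -/

section Blocks

variable {K : Type} [Field K] (a : K)

/-- `κ κ⁻¹ = 1`, entry `(1,1)`. [cite: Li1992, §3] -/
theorem kl₁₁ (i : Fin 2) : ![a + 1, 0] i * ![0, a + 1] i + ![-1, 1] i * ![-1, 1] i = (1 : K) := by fin_cases i <;> simp
/-- `κ κ⁻¹ = 1`, entry `(1,2)`. [cite: Li1992, §3] -/
theorem kl₁₂ (i : Fin 2) : ![a + 1, 0] i * ![1, -1] i + ![-1, 1] i * ![a + 1, 0] i = (0 : K) := by fin_cases i <;> simp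
/-- `κ κ⁻¹ = 1`, entry `(2,1)`. [cite: Li1992, §3] -/
theorem kl₂₁ (i : Fin 2) : ![1, -1] i * ![0, a + 1] i + ![0, a + 1] i * ![-1, 1] i = (0 : K) := by fin_cases i <;> simp
/-- `κ κ⁻¹ = 1`, entry `(2,2)`. [cite: Li1992, §3] -/
theorem kl₂₂ (i : Fin 2) : ![1, -1] i * ![1, -1] i + ![0, a + 1] i * ![a + 1, 0] i = (1 : K) := by fin_cases i <;> simp

/-- unitarity across the dual lines (`κ₀ᵀ·diag(1,−1)·κ₁ = diag(1,−1)` and its transpose), block `(1,1)`. [cite: Li1992, §3] -/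
theorem ku₁₁ (i : Fin 2) : ![a + 1, 0] i * ![a + 1, 0] i.rev - ![1, -1] i * ![1, -1] i.rev = (1 : K) := by
  fin_cases i <;> simp [Fin.rev]
/-- unitarity across the dual lines, block `(1,2)`. [cite: Li1992, §3] -/
theorem ku₁₂ (i : Fin 2) : ![a + 1, 0] i * ![-1, 1] i.rev - ![1, -1] i * ![0, a + 1] i.rev = (0 : K) := by
  fin_cases i <;> simp [Fin.rev]
/-- unitarity across the dual lines, block `(2,1)`. [cite: Li1992, §3] -/
theorem ku₂₁ (i : Fin 2) : ![-1, 1] i * ![a + 1, 0] i.rev - ![0, a + 1] i * ![1, -1] i.rev = (0 : K) := by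
  fin_cases i <;> simp [Fin.rev]
/-- unitarity across the dual lines, block `(2,2)`. [cite: Li1992, §3] -/
theorem ku₂₂ (i : Fin 2) : ![-1, 1] i * ![-1, 1] i.rev - ![0, a + 1] i * ![0, a + 1] i.rev = (-1 : K) := by
  fin_cases i <;> simp [Fin.rev]

/-- the Siegel condition for `p = diag(a ⊕ a⁻¹, 1)·k⁻¹` per line: `p₁₁ + p₁₂ = p₂₁ + p₂₂`. [cite: Kudla1994, §3] -/
theorem siegel_line (ha : a ≠ 0) (i : Fin 2) :
    ![a, a⁻¹] i * ![0, a + 1] i + ![a, a⁻¹] i * ![1, -1] i = ![-1, 1] i + ![a + 1, 0] i := by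
  fin_cases i
  · simp
  · simp; field_simp; ring

/-- `det_Δ` per line: `p₁₁ + p₁₂ = (a, 1)`. [cite: Kudla1994, §3] -/
theorem detDelta_line (ha : a ≠ 0) (i : Fin 2) : ![a, a⁻¹] i * ![0, a + 1] i + ![a, a⁻¹] i * ![1, -1] i = ![a, 1] i := by
  fin_cases i
  · simp
  · simp; field_simp; ring

end Blocks

/-! ## §2 The `(n+n) × (n+n)` matrices in the hyperbolic frame (any field; `eL : Fin n ≃ Fin 2` the line enumeration) -/

section Frame

variable {R : Type} [CommRing R] {n : ℕ}

/-- re-enumeration along `e₂` is multiplicative. [folklore] -/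
theorem reindex_e₂_mul (M N : Matrix (Fin n ⊕ Fin n) (Fin n ⊕ Fin n) R) :
    Matrix.reindex (LocalSplitting.e₂ n) (LocalSplitting.e₂ n) M * Matrix.reindex (LocalSplitting.e₂ n) (LocalSplitting.e₂ n) N =
      Matrix.reindex (LocalSplitting.e₂ n) (LocalSplitting.e₂ n) (M * N) :=
  Matrix.submatrix_mul_equiv M N _ (LocalSplitting.e₂ n).symm _

omit [CommRing R] in
/-- re-enumeration along `e₂` commutes with entrywise maps. [folklore] -/
theorem reindex_e₂_map {S : Type} (M : Matrix (Fin n ⊕ Fin n) (Fin n ⊕ Fin n) R) (f : R → S) :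
    (Matrix.reindex (LocalSplitting.e₂ n) (LocalSplitting.e₂ n) M).map f = Matrix.reindex (LocalSplitting.e₂ n) (LocalSplitting.e₂ n) (M.map f) := by
  rw [Matrix.reindex_apply, Matrix.reindex_apply, Matrix.submatrix_map]

/-- conjugating a block matrix by a block-scalar frame `A ⊕ A` (with `B ⊕ B` on the left): blockwise `B X A`. [folklore] -/
theorem frame_conj_blocks (A B X Y Z W : Matrix (Fin n) (Fin n) R) :
    Matrix.reindex (LocalSplitting.e₂ n) (LocalSplitting.e₂ n) (Matrix.fromBlocks B 0 0 B) *
        Matrix.reindex (LocalSplitting.e₂ n) (LocalSplitting.e₂ n) (Matrix.fromBlocks X Y Z W) *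
        Matrix.reindex (LocalSplitting.e₂ n) (LocalSplitting.e₂ n) (Matrix.fromBlocks A 0 0 A) =
      Matrix.reindex (LocalSplitting.e₂ n) (LocalSplitting.e₂ n) (Matrix.fromBlocks (B * X * A) (B * Y * A) (B * Z * A) (B * W * A)) := by
  rw [reindex_e₂_mul, reindex_e₂_mul, Matrix.fromBlocks_multiply, Matrix.fromBlocks_multiply]
  simp only [Matrix.zero_mul, Matrix.mul_zero, add_zero, zero_add]

/-- block-scalar frames multiply blockwise: `(A ⊕ A)(B ⊕ B) = AB ⊕ AB`. [folklore] -/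
theorem frame_mul_frame (A B : Matrix (Fin n) (Fin n) R) :
    Matrix.reindex (LocalSplitting.e₂ n) (LocalSplitting.e₂ n) (Matrix.fromBlocks A 0 0 A) *
        Matrix.reindex (LocalSplitting.e₂ n) (LocalSplitting.e₂ n) (Matrix.fromBlocks B 0 0 B) =
      Matrix.reindex (LocalSplitting.e₂ n) (LocalSplitting.e₂ n) (Matrix.fromBlocks (A * B) 0 0 (A * B)) := by
  rw [reindex_e₂_mul, Matrix.fromBlocks_multiply]
  simp only [Matrix.zero_mul, Matrix.mul_zero, add_zero, zero_add]

/-- `1 ⊕ 1 = 1` after re-enumeration. [folklore] -/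
theorem reindex_fromBlocks_one_one :
    Matrix.reindex (LocalSplitting.e₂ n) (LocalSplitting.e₂ n) (Matrix.fromBlocks (1 : Matrix (Fin n) (Fin n) R) 0 0 1) = 1 := by
  rw [Matrix.fromBlocks_one, Matrix.reindex_apply, Matrix.submatrix_one_equiv]

/-- the form `J' ⊕ −J'` in a block-scalar frame `A ⊕ A`: `(σA ⊕ σA)ᵀ (J' ⊕ −J') (A ⊕ A) = (σAᵀ J' A) ⊕ −(σAᵀ J' A)`. [folklore] -/
theorem frame_transpose_mul_form_mul_frame (τ : R →+* R) (A J' : Matrix (Fin n) (Fin n) R) :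
    (((Matrix.reindex (LocalSplitting.e₂ n) (LocalSplitting.e₂ n) (Matrix.fromBlocks A 0 0 A)).map τ)ᵀ *
        Matrix.reindex (LocalSplitting.e₂ n) (LocalSplitting.e₂ n) (Matrix.fromBlocks J' 0 0 (-J')) *
        Matrix.reindex (LocalSplitting.e₂ n) (LocalSplitting.e₂ n) (Matrix.fromBlocks A 0 0 A)) =
      Matrix.reindex (LocalSplitting.e₂ n) (LocalSplitting.e₂ n)
        (Matrix.fromBlocks ((A.map τ)ᵀ * J' * A) 0 0 (-((A.map τ)ᵀ * J' * A))) := by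
  rw [reindex_e₂_map, Matrix.transpose_reindex, Matrix.fromBlocks_map, Matrix.fromBlocks_transpose, reindex_e₂_mul, reindex_e₂_mul,
    Matrix.fromBlocks_multiply, Matrix.fromBlocks_multiply]
  simp only [Matrix.map_zero _ (map_zero τ), Matrix.transpose_zero, Matrix.zero_mul, Matrix.mul_zero, add_zero, zero_add, Matrix.mul_neg,
    neg_zero, Matrix.neg_mul]

variable {K : Type} [Field K] (eL : Fin n ≃ Fin 2) (a : K)

/-- `k · k⁻¹ = 1` for the assembled `(n+n) × (n+n)` matrices. [cite: Li1992, §3] -/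
theorem kMat_mul_lMat :
    Matrix.reindex (LocalSplitting.e₂ n) (LocalSplitting.e₂ n)
        (Matrix.fromBlocks (diagonal fun j => ![a + 1, 0] (eL j)) (diagonal fun j => ![-1, 1] (eL j))
          (diagonal fun j => ![1, -1] (eL j)) (diagonal fun j => ![0, a + 1] (eL j))) *
      Matrix.reindex (LocalSplitting.e₂ n) (LocalSplitting.e₂ n)
        (Matrix.fromBlocks (diagonal fun j => ![0, a + 1] (eL j)) (diagonal fun j => ![1, -1] (eL j))
          (diagonal fun j => ![-1, 1] (eL j)) (diagonal fun j => ![a + 1, 0] (eL j))) = 1 := by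
  rw [reindex_fromBlocks_diagonal_mul]
  refine reindex_fromBlocks_diagonal_eq_one n ?_ ?_ ?_ ?_ <;> funext j <;> simp only [Pi.add_apply, Pi.mul_apply]
  exacts [kl₁₁ a (eL j), kl₁₂ a (eL j), kl₂₁ a (eL j), kl₂₂ a (eL j)]

/-- `diag(a ⊕ a⁻¹, 1) · k⁻¹ = p` (the per-line blocks `[[0, a], [−1, a+1]]`, `[[(a+1)/a, −1/a], [1, 0]]`). [cite: Li1992, §3] -/
theorem dMat_mul_lMat :
    Matrix.reindex (LocalSplitting.e₂ n) (LocalSplitting.e₂ n) (Matrix.fromBlocks (diagonal fun j => ![a, a⁻¹] (eL j)) 0 0 1) *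
      Matrix.reindex (LocalSplitting.e₂ n) (LocalSplitting.e₂ n)
        (Matrix.fromBlocks (diagonal fun j => ![0, a + 1] (eL j)) (diagonal fun j => ![1, -1] (eL j))
          (diagonal fun j => ![-1, 1] (eL j)) (diagonal fun j => ![a + 1, 0] (eL j))) =
      Matrix.reindex (LocalSplitting.e₂ n) (LocalSplitting.e₂ n)
        (Matrix.fromBlocks (diagonal fun j => ![a, a⁻¹] (eL j) * ![0, a + 1] (eL j)) (diagonal fun j => ![a, a⁻¹] (eL j) * ![1, -1] (eL j))
          (diagonal fun j => ![-1, 1] (eL j)) (diagonal fun j => ![a + 1, 0] (eL j))) := by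
  rw [reindex_e₂_mul, Matrix.fromBlocks_multiply]
  simp only [diagonal_mul_diagonal, Matrix.zero_mul, Matrix.one_mul, add_zero, zero_add]

/-- **unitarity of `k` in the hyperbolic frame**: `kᵀ · (J' ⊕ −J') · k = J' ⊕ −J'`, `J' = antidiag(1,1)` enumerated along `eL` (the entries of `k`
are `σ_w`-fixed, so no conjugation appears). [cite: Li1992, §3] -/
theorem kMat_transpose_mul_form_mul_kMat :
    (Matrix.reindex (LocalSplitting.e₂ n) (LocalSplitting.e₂ n)
        (Matrix.fromBlocks (diagonal fun j => ![a + 1, 0] (eL j)) (diagonal fun j => ![-1, 1] (eL j))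
          (diagonal fun j => ![1, -1] (eL j)) (diagonal fun j => ![0, a + 1] (eL j))))ᵀ *
      Matrix.reindex (LocalSplitting.e₂ n) (LocalSplitting.e₂ n)
        (Matrix.fromBlocks (((StdForm.antidiagonal 2).over K).submatrix eL eL) 0 0 (-((StdForm.antidiagonal 2).over K).submatrix eL eL)) *
      Matrix.reindex (LocalSplitting.e₂ n) (LocalSplitting.e₂ n)
        (Matrix.fromBlocks (diagonal fun j => ![a + 1, 0] (eL j)) (diagonal fun j => ![-1, 1] (eL j))
          (diagonal fun j => ![1, -1] (eL j)) (diagonal fun j => ![0, a + 1] (eL j))) =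
      Matrix.reindex (LocalSplitting.e₂ n) (LocalSplitting.e₂ n)
        (Matrix.fromBlocks (((StdForm.antidiagonal 2).over K).submatrix eL eL) 0 0 (-((StdForm.antidiagonal 2).over K).submatrix eL eL)) := by
  have hJ : ∀ j j' : Fin n, (((StdForm.antidiagonal 2).over K).submatrix eL eL) j j' = if eL j' = (eL j).rev then 1 else 0 := by
    intro j j'
    simp only [Matrix.submatrix_apply, StdForm.over, Matrix.map_apply, StdForm.antidiagonal_J_apply]
    split_ifs <;> simp
  rw [Matrix.transpose_reindex, Matrix.fromBlocks_transpose, diagonal_transpose, diagonal_transpose, diagonal_transpose, diagonal_transpose,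
    reindex_e₂_mul, reindex_e₂_mul, Matrix.fromBlocks_multiply, Matrix.fromBlocks_multiply]
  simp only [Matrix.mul_zero, add_zero, zero_add]
  refine congrArg _ ?_
  ext (j | j) (j' | j')
  · simp only [Matrix.fromBlocks_apply₁₁, Matrix.add_apply, Matrix.mul_neg, Matrix.neg_mul, Matrix.neg_apply, mul_diagonal, diagonal_mul, hJ]
    by_cases h : eL j' = (eL j).rev
    · rw [if_pos h, h]; linear_combination ku₁₁ a (eL j)
    · rw [if_neg h]; ring
  · simp only [Matrix.fromBlocks_apply₁₂, Matrix.add_apply, Matrix.mul_neg, Matrix.neg_mul, Matrix.neg_apply, mul_diagonal, diagonal_mul, hJ,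
      Matrix.zero_apply]
    by_cases h : eL j' = (eL j).rev
    · rw [if_pos h, h]; linear_combination ku₁₂ a (eL j)
    · rw [if_neg h]; ring
  · simp only [Matrix.fromBlocks_apply₂₁, Matrix.add_apply, Matrix.mul_neg, Matrix.neg_mul, Matrix.neg_apply, mul_diagonal, diagonal_mul, hJ,
      Matrix.zero_apply]
    by_cases h : eL j' = (eL j).rev
    · rw [if_pos h, h]; linear_combination ku₂₁ a (eL j)
    · rw [if_neg h]; ring
  · simp only [Matrix.fromBlocks_apply₂₂, Matrix.add_apply, Matrix.mul_neg, Matrix.neg_mul, Matrix.neg_apply, mul_diagonal, diagonal_mul, hJ]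
    by_cases h : eL j' = (eL j).rev
    · rw [if_pos h, h]; linear_combination ku₂₂ a (eL j)
    · rw [if_neg h]; ring

end Frame

/-! ## §3 The closed form at an inert place -/

variable (L : Type) [Field L] [NumberField L] [IsCMField L]
variable {n : ℕ} (e : Fin 2 × Fin 1 ≃ Fin n)
  (dV : Fin 2 → L) (hdV : ∀ i, IsCMField.complexConj L (dV i) = dV i)
  (dW : Fin 1 → L) (hdW : ∀ i, IsCMField.complexConj L (dW i) = dW i)
  (v : HeightOneSpectrum (𝓞 (Fp L)))

omit [NumberField L] [IsCMField L] in
/-- `reindex e (X ⊗ 1₁) = X` enumerated along the lines `eL = pr₁ ∘ e⁻¹`. [folklore] -/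
theorem reindex_kronecker_one_eq_submatrix {R : Type} [CommRing R] (X : Matrix (Fin 2) (Fin 2) R) :
    Matrix.reindex e e (X ⊗ₖ (1 : Matrix (Fin 1) (Fin 1) R)) =
      X.submatrix (e.symm.trans (Equiv.prodUnique (Fin 2) (Fin 1))) (e.symm.trans (Equiv.prodUnique (Fin 2) (Fin 1))) := by
  ext j j'
  simp only [Matrix.reindex_apply, Matrix.submatrix_apply, Matrix.kroneckerMap_apply, Equiv.trans_apply, Equiv.prodUnique_apply]
  rw [Subsingleton.elim (e.symm j).2 (e.symm j').2, Matrix.one_apply_eq, mul_one]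

/-- the doubled Gram matrix `T₀ ⊗ L_w` of the curve datum at `w`, in the hyperbolic frame: `gramW = dW₀ · (σ_w T')ᵀ · J' · T'` with
`T' = T` and `J' = antidiag(1,1)` enumerated along the lines. [cite: HarrisKudlaSweet1996, §1 (1.9)] -/
theorem gramW_eq_smul_frame (w : UnitaryGroup.PlacesOver L v) (hw : IsCMField.complexConj L • w.1 = w.1)
    (T : GL (Fin 2) (w.1.adicCompletion L))
    (hTJ : UnitaryGroup.placeForm (Matrix.diagonal dV) w.1 =
      formCongr (galAdicCompletionMap (L := L) (IsCMField.complexConj L) hw) T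
        ((StdForm.antidiagonal 2).over (w.1.adicCompletion L))) :
    LocalSplitting.gramW (Fp L) L v n (T₀ := gramR L e dV hdV dW hdW) w =
      algebraMap L (w.1.adicCompletion L) (dW 0) •
        ((((T : Matrix (Fin 2) (Fin 2) (w.1.adicCompletion L)).submatrix (e.symm.trans (Equiv.prodUnique (Fin 2) (Fin 1)))
              (e.symm.trans (Equiv.prodUnique (Fin 2) (Fin 1)))).map
            (galAdicCompletionMap (L := L) (IsCMField.complexConj L) hw))ᵀ *
          ((StdForm.antidiagonal 2).over (w.1.adicCompletion L)).submatrix (e.symm.trans (Equiv.prodUnique (Fin 2) (Fin 1)))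
            (e.symm.trans (Equiv.prodUnique (Fin 2) (Fin 1))) *
          (T : Matrix (Fin 2) (Fin 2) (w.1.adicCompletion L)).submatrix (e.symm.trans (Equiv.prodUnique (Fin 2) (Fin 1)))
            (e.symm.trans (Equiv.prodUnique (Fin 2) (Fin 1)))) := by
  set eL := e.symm.trans (Equiv.prodUnique (Fin 2) (Fin 1)) with heL
  -- the frame identity, enumerated along the lines
  have hsub : (((T : Matrix (Fin 2) (Fin 2) (w.1.adicCompletion L)).submatrix eL eL).map
        (galAdicCompletionMap (L := L) (IsCMField.complexConj L) hw))ᵀ *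
      ((StdForm.antidiagonal 2).over (w.1.adicCompletion L)).submatrix eL eL *
      (T : Matrix (Fin 2) (Fin 2) (w.1.adicCompletion L)).submatrix eL eL =
      (UnitaryGroup.placeForm (Matrix.diagonal dV) w.1).submatrix eL eL := by
    rw [← Matrix.submatrix_map, Matrix.transpose_submatrix, Matrix.submatrix_mul_equiv, Matrix.submatrix_mul_equiv, hTJ]
  rw [hsub]
  ext j j'
  have h2 : (e.symm j).2 = (e.symm j').2 := Subsingleton.elim _ _
  simp only [LocalSplitting.gramW, gramR, UnitaryDualPair.gram, realDiagonal, Matrix.map_apply, Matrix.reindex_apply, Matrix.submatrix_apply, Matrix.kroneckerMap_apply,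
    Matrix.smul_apply, smul_eq_mul, UnitaryGroup.placeForm, heL, Equiv.trans_apply, Equiv.prodUnique_apply, diagonal_apply, h2, if_true]
  by_cases h : (e.symm j).1 = (e.symm j').1
  · rw [if_pos h, if_pos h, Subsingleton.elim (e.symm j').2 0, map_mul, map_mul, mul_comm]
    rfl
  · rw [if_neg h, if_neg h, zero_mul, map_zero, map_zero, mul_zero]

end Summit.HodgeConjecture.HodgeConjecture.Cruxes.HLiu418.K2LiuInertCartanIwasawaBlocks

end
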